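import Summits.KontsevichZagierPeriods.Zeta5Search.WedgeDictionaryLevelDescentVFullCwRatio
import Summits.KontsevichZagierPeriods.Zeta5Search.WedgeDictionaryLevelDescentVFullRecK
import HarnessLib

/-!
# The REL-(3) certificate: identities and the termwise step (T3 descent, step L4a)

HONEST FRAMING: "systematic search; no irrationality claim unless certified".

Ingredients, all PROVED upstream: the K-module form `Y(b) = Σ_μ Cw(b;μ)·K_μ` and the ratios R1/R2 of the combined weight
(`WedgeDictionaryLevelDescentVFullKModule`, `…CwRatio`), and REC-K `p₂(μ)K_{μ+2} + p₁(μ)K_{μ+1} + p₀(μ)K_μ = 0`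
(`WedgeDictionaryLevelDescentVFullRecK`).  Here: the closed-form creative-telescoping certificate for the slot-1 relation
`d·Y(b+2e₁) + Γ₁r₂·Y(b+e₁) + Γ₀r₁r₂·Y(b) = 0` (`ldY_rel3_stmt`):

* `certM0 b t = (c₁₂+1−t)·p₁(t−1) − (t−1)(b₁+1+t)(2N−e₁+t)(b₂−1+t)` and the two polynomial identities
  `certA_identity` (the `K_μ`-coefficient; one `ring`) and `certM0_succ` (the `K_{μ+1}`-coefficient);
* the certificate `certK b μ = Cw(b;μ)(b₂+μ)·Pc·r₁r₂·(m₀(μ)K_μ + (c₁₂+1−μ)PB(μ)K_{μ+1}) / ((N+1−b₁)(N−b₁)(d+1)(b₁+1+μ))`;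
* TERMWISE (`rel3_termwise`): for every admissible row (`c₁₂ ≥ 1`, `b₂ ≥ 1`, `b₇ = 0`) and every `μ ≥ 1`,
  `(d·Cw(b+2e₁;μ) + Γ₁r₂·Cw(b+e₁;μ) + Γ₀r₁r₂·Cw(b;μ))·K_μ = certK b (μ+1) − certK b μ`.

The boundary values and the summation (`ldY_rel3_holds`, `levelDescentVFull_holds`) are in `WedgeDictionaryLevelDescentVFullRel3`.
CREDIT: the certificate (closed form of `m₀`, the identities (I-K0)/(I-K1) and the boundary identity) was found and verified
exactly by the shared engine eng-exactrec-1 (delivery zeta5ct-0.1, F-zeta5-CT2: `Rel3Certificate.lean` rel3_main / rel3_step /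
rel3_boundary, rel3_closed.py, rel3_route2.py); it is restated here in the tree's row coordinates.  Exact cross-checks:
pub-zeta5 g9 `e7_kmodule.py` (K0 120/120, TW 489/489, BD/SUM/REL3 77/77), `e7b_edge.py` (edge rows), `L4/tw_check2.py`, `L4/k0_check.py`.
-/

open Finset

namespace Summit.KontsevichZagierPeriods.Zeta5Search.WedgeDictionary

open Summit.KontsevichZagierPeriods.Zeta5Search.DualSeries

/-! ## Polynomial data of the certificate -/

/-- `p₁` of REC-K at a rational argument (`kerP1 b μ = kP1 b μ`). -/
def kP1 (b : ℕ → ℤ) (t : ℚ) : ℚ :=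
  -2 * t ^ 3 + (-6 * (b 0 : ℚ) + 2 * esB1 b - 8) * t ^ 2 +
      (-5 * (b 0 : ℚ) ^ 2 + 3 * (b 0 : ℚ) * esB1 b - 15 * (b 0 : ℚ) + 5 * esB1 b - esB2 b - 11) * t +
    (-(b 0 : ℚ) ^ 3 + (b 0 : ℚ) ^ 2 * esB1 b - 5 * (b 0 : ℚ) ^ 2 + 3 * (b 0 : ℚ) * esB1 b - (b 0 : ℚ) * esB2 b -
      9 * (b 0 : ℚ) + 3 * esB1 b - esB2 b + esB3 b - 5)

/-- `kerP1` is `kP1` at the natural argument. -/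
theorem kerP1_eq (b : ℕ → ℤ) (μ : ℕ) : kerP1 b μ = kP1 b μ := rfl

/-- `m₀(t) = (c₁₂+1−t)·p₁(t−1) − (t−1)(b₁+1+t)(2N−e₁+t)(b₂−1+t)`. -/
def certM0 (b : ℕ → ℤ) (t : ℚ) : ℚ :=
  ((b 0 : ℚ) - b 1 - b 2 + 1 - t) * kP1 b (t - 1) -
    (t - 1) * ((b 1 : ℚ) + 1 + t) * (2 * (b 0 : ℚ) - esB1 b + t) * ((b 2 : ℚ) - 1 + t)

/-- `Pc₁ = ∏_{j∈B}(c₁ⱼ − 1)` (`= ldPc (b+e₁)`). -/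
def ldPc1 (b : ℕ → ℤ) : ℚ :=
  ((b 0 : ℚ) - b 1 - b 3 - 1) * ((b 0 : ℚ) - b 1 - b 4 - 1) * ((b 0 : ℚ) - b 1 - b 5 - 1) * ((b 0 : ℚ) - b 1 - b 6 - 1)

/-- `r₁ = (b₁+1)(N−b₁)`. -/
def ldR1 (b : ℕ → ℤ) : ℚ := ((b 1 : ℚ) + 1) * ((b 0 : ℚ) - b 1)

/-- `r₂ = (b₁+2)(N−b₁−1)`. -/
def ldR2 (b : ℕ → ℤ) : ℚ := ((b 1 : ℚ) + 2) * ((b 0 : ℚ) - b 1 - 1)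

/-- `E = (N+1−b₁)(N−b₁)(d+1)`. -/
def certE (b : ℕ → ℤ) : ℚ := ((b 0 : ℚ) + 1 - b 1) * ((b 0 : ℚ) - b 1) * ((dOf b : ℚ) + 1)

/-- `ldPc (b+e₁) = Pc₁`. -/
theorem ldPc_bump0 (b : ℕ → ℤ) : ldPc (bump b 0) = ldPc1 b := by
  obtain ⟨e0, e1, _, e3, e4, e5, e6, _⟩ := bump0_vals b
  simp only [ldPc, ldPc1, e0, e1, e3, e4, e5, e6]
  push_cast
  ring

/-- `p₂(μ) = PB(μ+1)`. -/
theorem kerP2_eq_ldPB (b : ℕ → ℤ) (μ : ℕ) : kerP2 b μ = ldPB b (μ + 1) := by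
  simp only [kerP2, ldPB]
  push_cast
  ring

set_option maxHeartbeats 4000000 in
/-- (I-K0), the `K_μ`-coefficient of the certificate identity (eng-exactrec-1 `rel3_main`, in row coordinates; `b₇ = 0`):
`(c+1−μ)(c−μ)·Pc₁ + Γ₁·(c+1−μ)(N−b₁)(b₁+2+μ) + c·E·(b₁+1+μ)(b₁+2+μ) + (b₂+μ)(b₁+2+μ)·m₀(μ) − (c+1−μ)(c−μ)·PB(μ) = 0`. -/
theorem certA_identity (b : ℕ → ℤ) (hb7 : b 7 = 0) (μ : ℕ) :
    ((b 0 : ℚ) - b 1 - b 2 + 1 - μ) * ((b 0 : ℚ) - b 1 - b 2 - μ) * ldPc1 b +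
            faceGamma1 b 0 * (((b 0 : ℚ) - b 1 - b 2 + 1 - μ) * ((b 0 : ℚ) - b 1) * ((b 1 : ℚ) + 2 + μ)) +
          ((b 0 : ℚ) - b 1 - b 2) * (certE b * ((b 1 : ℚ) + 1 + μ) * ((b 1 : ℚ) + 2 + μ)) +
        ((b 2 : ℚ) + μ) * ((b 1 : ℚ) + 2 + μ) * certM0 b μ -
      ((b 0 : ℚ) - b 1 - b 2 + 1 - μ) * ((b 0 : ℚ) - b 1 - b 2 - μ) * ldPB b μ = 0 := by
  have hd : (dOf b : ℚ) = 3 * (b 0 : ℚ) - b 1 - b 2 - b 3 - b 4 - b 5 - b 6 := by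
    simp only [dOf, sum_range_succ, sum_range_zero, Nat.reduceAdd, hb7]
    push_cast
    ring
  simp only [ldPc1, faceGamma1, fe1, fe2, fe3, certE, certM0, kP1, esB1, esB2, esB3, ldPB, Nat.reduceAdd, hd]
  ring

/-- (I-K1), the `K_{μ+1}`-coefficient: `(c−μ)·p₁(μ) − m₀(μ+1) = p₀(μ)·(b₂+μ)(b₁+2+μ)`. -/
theorem certM0_succ (b : ℕ → ℤ) (μ : ℕ) :
    ((b 0 : ℚ) - b 1 - b 2 - μ) * kP1 b μ - certM0 b ((μ : ℚ) + 1) =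
      kerP0 b μ * ((b 2 : ℚ) + μ) * ((b 1 : ℚ) + 2 + μ) := by
  simp only [certM0, kerP0, add_sub_cancel_right]
  ring

/-! ## The certificate and the termwise identity -/

/-- Numerator of the certificate: `Cw(b;μ)(b₂+μ)·Pc·r₁r₂·(m₀(μ)K_μ + (c₁₂+1−μ)PB(μ)K_{μ+1})`. -/
def certKn (b : ℕ → ℤ) (μ : ℕ) : ℚ :=
  ldCw b μ * ((b 2 : ℚ) + μ) * ldPc b * ldR1 b * ldR2 b *
    (certM0 b μ * ldKer b μ + ((b 0 : ℚ) - b 1 - b 2 + 1 - μ) * ldPB b μ * ldKer b (μ + 1))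

/-- The certificate `Cert_μ = certKn b μ / (E·(b₁+1+μ))`. -/
def certK (b : ℕ → ℤ) (μ : ℕ) : ℚ := certKn b μ / (certE b * ((b 1 : ℚ) + 1 + μ))

/-- The `μ`-th term of `d·Y(b+2e₁) + Γ₁r₂·Y(b+e₁) + Γ₀r₁r₂·Y(b)` in K-module form. -/
def rel3T (b : ℕ → ℤ) (μ : ℕ) : ℚ :=
  ((dOf b : ℚ) * ldCw (bump (bump b 0) 0) μ + faceGamma1 b 0 * ldR2 b * ldCw (bump b 0) μ +
      faceGamma0 b 0 * (ldR1 b * ldR2 b) * ldCw b μ) * ldKer b μ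

/-- Cast helper: a rational that is the cast of a positive integer is nonzero. -/
theorem ne_zero_of_eq_intCast {z : ℤ} (q : ℚ) (hq : q = (z : ℚ)) (hz : 0 < z) : q ≠ 0 := by
  rw [hq]; exact_mod_cast hz.ne'

/-- The box hypotheses of `b + e₁` from those of `b` (needs `b₁ + 1 ≤ N`). -/
theorem rowBox_bump0 (b : ℕ → ℤ) (hbox : ∀ j ∈ Icc 1 7, 0 ≤ b j ∧ b j ≤ b 0) (h1 : b 1 + 1 ≤ b 0) :
    ∀ j ∈ Icc 1 7, 0 ≤ bump b 0 j ∧ bump b 0 j ≤ bump b 0 0 := by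
  intro j hj
  have h := hbox j hj
  have hx1 := hbox 1 (by simp)
  rw [bump0_of_ne b (show (0 : ℕ) ≠ 1 by decide), bump0_apply]
  split_ifs with hj1
  · constructor <;> omega
  · exact h

/-- The half-box hypotheses of `b + e₁` on `B`. -/
theorem halfBox_bump0 (b : ℕ → ℤ) (hB : ∀ j ∈ Icc 3 6, 2 * b j ≤ b 0) :
    ∀ j ∈ Icc 3 6, 2 * bump b 0 j ≤ bump b 0 0 := by
  intro j hj
  have hj' := hj
  simp only [mem_Icc] at hj'
  rw [bump0_of_ne b (show (0 : ℕ) ≠ 1 by decide), bump0_of_ne b (show j ≠ 1 by omega)]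
  exact hB j hj

set_option maxHeartbeats 1600000 in
/-- TERMWISE IDENTITY of the REL-(3) certificate: for admissible rows with `c₁₂ ≥ 1` and every `μ ≥ 1`,
`(d·Cw(b+2e₁;μ) + Γ₁r₂·Cw(b+e₁;μ) + Γ₀r₁r₂·Cw(b;μ))·K_μ = Cert_{μ+1} − Cert_μ`. -/
theorem rel3_termwise (b : ℕ → ℤ) (hN : 0 ≤ b 0) (hbox : ∀ j ∈ Icc 1 7, 0 ≤ b j ∧ b j ≤ b 0)
    (hB : ∀ j ∈ Icc 3 6, 2 * b j ≤ b 0) (hb2 : 1 ≤ b 2) (hb7 : b 7 = 0) (hc : b 1 + b 2 + 1 ≤ b 0)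
    (μ : ℕ) (hμ : 1 ≤ μ) : rel3T b μ = certK b (μ + 1) - certK b μ := by
  obtain ⟨e0, e1, e2, e3, e4, e5, e6, e7⟩ := bump0_vals b
  have hbox' := hbox; have hB' := hB
  simp only [mem_Icc] at hbox' hB'
  have hx1 := hbox' 1 (by norm_num); have hx2 := hbox' 2 (by norm_num); have hx3 := hbox' 3 (by norm_num)
  have hx4 := hbox' 4 (by norm_num); have hx5 := hbox' 5 (by norm_num); have hx6 := hbox' 6 (by norm_num)
  have hB3 := hB' 3 (by norm_num); have hB4 := hB' 4 (by norm_num); have hB5 := hB' 5 (by norm_num)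
  have hB6 := hB' 6 (by norm_num)
  have hd0 := layer_le_dOf b hB hb7
  have hBK : ∀ j ∈ Icc 3 6, 0 ≤ b j ∧ b j ≤ b 0 := fun j hj => by
    have hj' := hj; simp only [mem_Icc] at hj'; exact hbox j (by simp only [mem_Icc]; omega)
  have hboxp := rowBox_bump0 b hbox (by omega)
  have hBp := halfBox_bump0 b hB
  -- the inputs
  have hR1 := ldCw_succ b hbox hB hb2 hb7 μ hμ
  have hR2 := ldCw_bump0 b hbox hB hb2 hb7 μ hμ
  have hR2p := ldCw_bump0 (bump b 0) hboxp hBp (by rw [e2]; exact hb2) (by rw [e7]; exact hb7) μ hμ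
  have hK := ldKer_recK b hN hBK μ hμ
  have hA := certA_identity b hb7 μ
  have hM := certM0_succ b μ
  -- normalised forms over the atoms of the final combination
  have hR1' : ldCw b (μ + 1) * (kerP0 b μ * ((b 1 : ℚ) + 1 + μ) * ((b 2 : ℚ) + 1 + μ)) =
      -(ldCw b μ * (((b 0 : ℚ) - b 1 - b 2 + 1 - μ) * ldPB b μ)) := by
    rw [← hR1]; simp only [kerP0, esB1, sumB]; push_cast; ring
  have hY1 : ldCw (bump b 0) μ * (certE b * ((b 1 : ℚ) + 1 + μ)) =
      ldCw b μ * (((b 0 : ℚ) - b 1 - b 2 + 1 - μ) * ldPc b * ldR1 b * ((b 0 : ℚ) - b 1)) := by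
    simp only [certE, ldR1]; linear_combination ((b 0 : ℚ) - b 1) * hR2
  have hY2 : ldCw (bump (bump b 0) 0) μ * ((dOf b : ℚ) * ((b 1 : ℚ) + 1 + μ) * ((b 1 : ℚ) + 2 + μ) * certE b) =
      ldCw b μ * (((b 0 : ℚ) - b 1 - b 2 + 1 - μ) * ((b 0 : ℚ) - b 1 - b 2 - μ) * ldPc b * ldPc1 b *
        (ldR1 b * ldR2 b)) := by
    rw [e0, e1, e2, dOf_bump b (by simp), ldPc_bump0] at hR2p
    push_cast at hR2p
    simp only [certE, ldR1, ldR2]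
    linear_combination (((b 1 : ℚ) + 1 + μ) * ((b 0 : ℚ) + 1 - b 1) * ((dOf b : ℚ) + 1)) * hR2p +
      (((b 0 : ℚ) - b 1 - b 2 - μ) * ldPc1 b * (((b 1 : ℚ) + 2) * ((b 0 : ℚ) - b 1 - 1))) * hR2
  rw [kerP2_eq_ldPB, kerP1_eq] at hK
  have hΓ0 : faceGamma0 b 0 = ((b 0 : ℚ) - b 1 - b 2) * ldPc b := by rw [faceGamma0_slot1, ldPc]; ring
  -- nonvanishing denominators
  have hE : certE b ≠ 0 := ne_zero_of_eq_intCast _ (by simp only [certE]; push_cast; ring)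
    (show (0 : ℤ) < (b 0 + 1 - b 1) * (b 0 - b 1) * (dOf b + 1) from mul_pos (mul_pos (by omega) (by omega)) (by omega))
  have hq0 : (b 1 : ℚ) + 1 + μ ≠ 0 := ne_zero_of_eq_intCast _ (by push_cast; ring) (show (0 : ℤ) < b 1 + 1 + μ by omega)
  have hq1 : (b 1 : ℚ) + 1 + ((μ : ℚ) + 1) ≠ 0 :=
    ne_zero_of_eq_intCast _ (by push_cast; ring) (show (0 : ℤ) < b 1 + 2 + μ by omega)
  have hD1 : kerP0 b μ * ((b 1 : ℚ) + 1 + μ) * ((b 2 : ℚ) + 1 + μ) ≠ 0 :=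
    ne_zero_of_eq_intCast _ (by simp only [kerP0, esB1]; push_cast; ring)
      (show (0 : ℤ) < (μ : ℤ) * ((μ : ℤ) + 2 * b 0 + 1 - (b 3 + b 4 + b 5 + b 6)) * (b 1 + 1 + μ) * (b 2 + 1 + μ) from
        mul_pos (mul_pos (mul_pos (by omega) (by omega)) (by omega)) (by omega))
  have hden1 : certE b * ((b 1 : ℚ) + 1 + ((μ : ℚ) + 1)) ≠ 0 := mul_ne_zero hE hq1
  have hden0 : certE b * ((b 1 : ℚ) + 1 + μ) ≠ 0 := mul_ne_zero hE hq0
  simp only [certK]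
  push_cast
  rw [div_sub_div _ _ hden1 hden0, eq_div_iff (mul_ne_zero hden1 hden0)]
  apply mul_right_cancel₀ hD1
  simp only [rel3T, certKn, hΓ0, show μ + 1 + 1 = μ + 2 from rfl]
  push_cast
  linear_combination
    (-(((b 2 : ℚ) + μ + 1) * ldPc b * ldR1 b * ldR2 b *
        (certM0 b ((μ : ℚ) + 1) * ldKer b (μ + 1) + ((b 0 : ℚ) - b 1 - b 2 - μ) * ldPB b (μ + 1) * ldKer b (μ + 2)) *
        (certE b * ((b 1 : ℚ) + 1 + μ)))) * hR1' +
    (faceGamma1 b 0 * ldR2 b * ldKer b μ * certE b * ((b 1 : ℚ) + 2 + μ) *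
        (kerP0 b μ * ((b 1 : ℚ) + 1 + μ) * ((b 2 : ℚ) + 1 + μ))) * hY1 +
    (certE b * ldKer b μ * (kerP0 b μ * ((b 1 : ℚ) + 1 + μ) * ((b 2 : ℚ) + 1 + μ))) * hY2 +
    (ldCw b μ * ldPc b * ldR1 b * ldR2 b * certE b) *
      ((((b 0 : ℚ) - b 1 - b 2 + 1 - μ) * ((b 0 : ℚ) - b 1 - b 2 - μ) * ldPB b μ * ((b 2 : ℚ) + μ + 1) *
          ((b 1 : ℚ) + 1 + μ)) * hK +
        (kerP0 b μ * ((b 1 : ℚ) + 1 + μ) * ((b 2 : ℚ) + 1 + μ) * ldKer b μ) * hA +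
        (-(((b 0 : ℚ) - b 1 - b 2 + 1 - μ) * ldPB b μ * ((b 1 : ℚ) + 1 + μ) * ((b 2 : ℚ) + μ + 1)) * ldKer b (μ + 1)) * hM)

/-- Documentation anchor (TERMWISE IDENTITY, module docstring). -/
def rel3_termwise_stmt : Prop :=
  ∀ b : ℕ → ℤ, 0 ≤ b 0 → (∀ j ∈ Icc 1 7, 0 ≤ b j ∧ b j ≤ b 0) → (∀ j ∈ Icc 3 6, 2 * b j ≤ b 0) → 1 ≤ b 2 →
    b 7 = 0 → b 1 + b 2 + 1 ≤ b 0 → ∀ μ : ℕ, 1 ≤ μ → rel3T b μ = certK b (μ + 1) - certK b μ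

/-- `rel3_termwise_stmt` holds. -/
theorem rel3_termwise_holds : rel3_termwise_stmt := rel3_termwise

end Summit.KontsevichZagierPeriods.Zeta5Search.WedgeDictionary
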